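import Summits.QuantumFields.YangMills.Theorems.FemtoCutoffLadderUpStepEvGlue
import Summits.QuantumFields.YangMills.Theorems.FemtoTransferGapLevelsPos
import HarnessLib

/-!
# FemtoCutoffLadder — `PinnedUpStep` in NAMED kinematics, and «the constant `C` is idle» in the eventually-form steps

Seat ym-line-fcl-p3 g5 (2026-08-28).  R2b1 is a RECORD rung (`FemtoGapOfRecord`), not the Clay gap; every theorem below is an
implication between OPEN route items / explicit hypotheses; no summit and no crux is proved here.

Route `route-QuantumFields-FemtoCutoffLadder` (rev 23): `UpStepEv` (stmt-QuantumFields-26796, crux r5), its pinned engine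
`PinnedUpStep` (stmt-QuantumFields-26925, crux r501) and `Assembly3` (stmt-QuantumFields-26798); glue `upStepEv_of_pinnedUpStep`,
`assembly3_proof` landed by seat ym-idea-1 g5 (`…FemtoCutoffLadderUpStepEvGlue`).

1. `PinnedUpStepNamed.pinnedBody_iff`, `pinnedUpStep_iff_named` — the route decl writes the thinning map and the torus shift INLINE
   (its module imports only `FemtoTransferGap`); here the item is identified, once and for all, with its form in the tree's named
   kinematics `Thinning.thin L' (torusConfigShift v U)` and `transferApply β` — the form a supplier of 26925 proves and the doors
   (`UpStep.recentred_moments`, `UpStep.upStepAt_of_moments`) consume.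
2. «`C` IS IDLE» (`upStepEv_of_eventually`, `subOctaveBoundedEv_of_eventually`, `pinnedUpStep_of_eventually_named`): in every step
   statement whose lattice threshold `L₀` is chosen AFTER the level `lam` (the leaf's own quantifier pattern), the slack `exp(C·Λ²)` is,
   at level `lam`, a FIXED tolerance `≥ exp(C·lam²)`; hence the statement with `C = 1` already follows from the same comparison with an
   ARBITRARY tolerance `exp δ`, `δ > 0`, eventually in `L₀ = L₀(lam, δ)`.  So the honest content of `UpStepEv` / `PinnedUpStep` is a
   ONE-SIDED EVENTUAL comparison in the cutoff at fixed running parameter — a (one-sided) continuum-limit / Cauchy statement for the femto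
   gap, resp. for the time-1 vacuum autocorrelation of ONE pinned observable — with NO `O(Λ²)` matching, no rate, and no perturbative
   coefficient to reproduce.  (The `O(Λ²)` content of the ladder sits entirely in `OctaveStepDecay` — summable per-octave defect along ONE
   tower — and in the fixed-lattice law; the item AS FILED `SubOctaveBounded`, stmt-QuantumFields-24085, with `L₀` BEFORE `lam`, is the
   only incommensurable form in which `C` carries weight.)
-/

set_option autoImplicit false

noncomputable section

open MeasureTheory
open Literature.MathematicalPhysics.QuantumFieldTheory (Site Edge GaugeConfig torusConfigShift torusConfigShift_apply)
open Literature.MathematicalPhysics.QuantumLattice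

namespace Summit.QuantumFields.YangMills.Theorems.FemtoCutoffLadder.PinnedUpStepNamed

open Summit.QuantumFields.YangMills.Theorems.FemtoTransferGap
open Summit.QuantumFields.YangMills.Theorems.FemtoCutoffLadder.Thinning (thin)
open Summit.QuantumFields.YangMills.Theses.FemtoCutoffLadder (UpStepEv PinnedUpStep OctaveStepDecay)

/-! ### 1. The pinned item in named kinematics -/

/-- ★ **The inline body of `PinnedUpStep` at one pair equals its NAMED form** (`thin`, `torusConfigShift`, `transferApply`): the
`let`-block of the route decl, verbatim, on the left; the statement the door lemmas consume on the right (bridges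
`thin_eq_pinnedInline`, `torusConfigShift_eq_pinnedInline`; `K = transferApply β` by `rfl`). [folklore] -/
theorem pinnedBody_iff (L' : ℕ) [NeZero L'] (L : ℕ) [NeZero L] (C β β' : ℝ)
    (Ω : GaugeConfig 3 L SU2 → ℝ) (Ω' φ' : GaugeConfig 3 L' SU2 → ℝ) :
    (let T : GaugeConfig 3 L SU2 → GaugeConfig 3 L' SU2 := fun U e' =>
      (List.ofFn fun t : Fin (if (e'.1 e'.2).val < L - L' then 2 else 1) =>
        U ((fun j => (((e'.1 j).val + min (e'.1 j).val (L - L') : ℕ) : ZMod L)) + Pi.single e'.2 ((t : ℕ) : ZMod L), e'.2)).prod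
    let fbar : GaugeConfig 3 L SU2 → ℝ := fun U =>
      (Fintype.card (Site 3 L) : ℝ)⁻¹ * ∑ v : Site 3 L, φ' (T fun e => U (e.1 - v, e.2)) / Ω' (T fun e => U (e.1 - v, e.2))
    let ψ : GaugeConfig 3 L SU2 → ℝ := fun U => fbar U * Ω U
    let K : (GaugeConfig 3 L SU2 → ℝ) → (GaugeConfig 3 L SU2 → ℝ) := fun χ U =>
      ∫ V, transferKernel su2Rep β U V * χ V ∂(configMeasure SU2 L)
    l2 ψ Ω ^ 2 < l2 ψ ψ ∧
      secondValue su2Rep L' β' ^ L' * topValue su2Rep L β ^ L * (l2 ψ ψ - l2 ψ Ω ^ 2) ≤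
        Real.exp (C * luscherLambda β L ^ 2) *
          (topValue su2Rep L' β' ^ L' * (l2 ψ (K^[L] ψ) - topValue su2Rep L β ^ L * l2 ψ Ω ^ 2))) ↔
    (let ψ : GaugeConfig 3 L SU2 → ℝ := fun U =>
      ((Fintype.card (Site 3 L) : ℝ)⁻¹ *
        ∑ v : Site 3 L, φ' (thin L' (torusConfigShift v U)) / Ω' (thin L' (torusConfigShift v U))) * Ω U
    l2 ψ Ω ^ 2 < l2 ψ ψ ∧
      secondValue su2Rep L' β' ^ L' * topValue su2Rep L β ^ L * (l2 ψ ψ - l2 ψ Ω ^ 2) ≤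
        Real.exp (C * luscherLambda β L ^ 2) *
          (topValue su2Rep L' β' ^ L' * (l2 ψ ((transferApply β)^[L] ψ) - topValue su2Rep L β ^ L * l2 ψ Ω ^ 2))) := by
  have hK : (fun (χ : GaugeConfig 3 L SU2 → ℝ) (U : GaugeConfig 3 L SU2) =>
      ∫ V, transferKernel su2Rep β U V * χ V ∂(configMeasure SU2 L)) = transferApply (L := L) β := by
    funext χ U; rfl
  have hψ : (fun U : GaugeConfig 3 L SU2 =>
      ((Fintype.card (Site 3 L) : ℝ)⁻¹ *
        ∑ v : Site 3 L, φ' (thin L' (torusConfigShift v U)) / Ω' (thin L' (torusConfigShift v U))) * Ω U) =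
      fun U : GaugeConfig 3 L SU2 =>
        ((Fintype.card (Site 3 L) : ℝ)⁻¹ * ∑ v : Site 3 L,
          φ' ((fun (U : GaugeConfig 3 L SU2) (e' : Edge 3 L') =>
                (List.ofFn fun t : Fin (if (e'.1 e'.2).val < L - L' then 2 else 1) =>
                  U ((fun j => (((e'.1 j).val + min (e'.1 j).val (L - L') : ℕ) : ZMod L)) + Pi.single e'.2 ((t : ℕ) : ZMod L), e'.2)).prod)
              fun e => U (e.1 - v, e.2)) /
          Ω' ((fun (U : GaugeConfig 3 L SU2) (e' : Edge 3 L') =>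
                (List.ofFn fun t : Fin (if (e'.1 e'.2).val < L - L' then 2 else 1) =>
                  U ((fun j => (((e'.1 j).val + min (e'.1 j).val (L - L') : ℕ) : ZMod L)) + Pi.single e'.2 ((t : ℕ) : ZMod L), e'.2)).prod)
              fun e => U (e.1 - v, e.2))) * Ω U := by
    funext U
    simp only [torusConfigShift_eq_pinnedInline, thin_eq_pinnedInline]
  simp only []
  rw [hK, ← hψ]

/-- ★ **`PinnedUpStep` (stmt-QuantumFields-26925) in NAMED kinematics** — the same quantifier block, with
`ψ̄ U = (|Λ_L|⁻¹ Σ_v (φ'/Ω')(thin L' (τ_v U)))·Ω U` and `K = transferApply β`: the form a supplier proves and the doors consume.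
[cite: Luscher1983, §2] -/
theorem pinnedUpStep_iff_named : PinnedUpStep ↔
    ∃ C lam0 : ℝ, 0 < lam0 ∧ ∀ lam : ℝ, 0 < lam → lam ≤ lam0 → ∃ L0 : ℕ,
      ∀ (L' : ℕ) [NeZero L'] (L : ℕ) [NeZero L], L0 ≤ L' → L' < L → L < 2 * L' → ∀ β β' : ℝ,
        InFemtoWindow lam β L → InFemtoWindow lam β' L' → luscherLambda β L = luscherLambda β' L' →
        ∀ Ω : GaugeConfig 3 L SU2 → ℝ, IsPhys Ω → (∀ U, 0 < Ω U) → l2 Ω Ω = 1 →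
          (∀ U, ∫ V, transferKernel su2Rep β U V * Ω V ∂(configMeasure SU2 L) = topValue su2Rep L β * Ω U) →
        ∀ Ω' : GaugeConfig 3 L' SU2 → ℝ, IsPhys Ω' → ∀ c' : ℝ, 0 < c' → (∀ U', c' ≤ Ω' U') → l2 Ω' Ω' = 1 →
          (∀ U', ∫ V', transferKernel su2Rep β' U' V' * Ω' V' ∂(configMeasure SU2 L') = topValue su2Rep L' β' * Ω' U') →
        ∀ φ' : GaugeConfig 3 L' SU2 → ℝ, IsPhys φ' → l2 φ' Ω' = 0 → l2 φ' φ' = 1 →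
          (∀ U', ∫ V', transferKernel su2Rep β' U' V' * φ' V' ∂(configMeasure SU2 L') = secondValue su2Rep L' β' * φ' U') →
        let ψ : GaugeConfig 3 L SU2 → ℝ := fun U =>
          ((Fintype.card (Site 3 L) : ℝ)⁻¹ *
            ∑ v : Site 3 L, φ' (thin L' (torusConfigShift v U)) / Ω' (thin L' (torusConfigShift v U))) * Ω U
        l2 ψ Ω ^ 2 < l2 ψ ψ ∧
          secondValue su2Rep L' β' ^ L' * topValue su2Rep L β ^ L * (l2 ψ ψ - l2 ψ Ω ^ 2) ≤
            Real.exp (C * luscherLambda β L ^ 2) *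
              (topValue su2Rep L' β' ^ L' * (l2 ψ ((transferApply β)^[L] ψ) - topValue su2Rep L β ^ L * l2 ψ Ω ^ 2)) := by
  unfold PinnedUpStep
  refine exists_congr fun C => exists_congr fun lam0 => and_congr_right fun _ => ?_
  refine forall₃_congr fun lam _ _ => exists_congr fun L0 => ?_
  refine forall₂_congr fun L' _ => forall₂_congr fun L _ => forall₃_congr fun _ _ _ => ?_
  refine forall₂_congr fun β β' => forall₃_congr fun _ _ _ => ?_
  refine forall₂_congr fun Ω _ => forall₃_congr fun _ _ _ => ?_
  refine forall₂_congr fun Ω' _ => forall₂_congr fun c' _ => forall₃_congr fun _ _ _ => ?_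
  refine forall₂_congr fun φ' _ => forall₃_congr fun _ _ _ => ?_
  exact pinnedBody_iff L' L C β β' Ω Ω' φ'

/-! ### 2. «`C` is idle»: with the threshold after the level, any fixed tolerance per window suffices -/

/-- Arithmetic: a non-negative quantity below `e^δ·X` is below `e^ε·X` for every `ε ≥ δ` (if `X < 0` the hypothesis is absurd). [folklore] -/
theorem le_exp_mul_mono {a X δ ε : ℝ} (ha : 0 ≤ a) (hδε : δ ≤ ε) (h : a ≤ Real.exp δ * X) : a ≤ Real.exp ε * X := by
  rcases le_or_gt 0 X with hX | hX
  · exact h.trans (mul_le_mul_of_nonneg_right (Real.exp_le_exp.mpr hδε) hX)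
  · exact absurd (h.trans_lt (mul_neg_of_pos_of_neg (Real.exp_pos δ) hX)) (not_lt.mpr ha)

/-- In the window at level `lam` the tolerance `lam²` is dominated by `1·Λ²`. [folklore] -/
theorem sq_le_one_mul_luscherLambda_sq {lam β : ℝ} {L : ℕ} (hlam : 0 < lam) (hW : InFemtoWindow lam β L) :
    lam ^ 2 ≤ 1 * luscherLambda β L ^ 2 := by
  rw [one_mul]; exact pow_le_pow_left₀ hlam.le hW.2.1 2

/-- ★★ **`C` is idle in `UpStepEv`** (stmt-QuantumFields-26796).  If for every small level `lam` and EVERY tolerance `δ > 0` the upward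
comparison `λ₁(L')^{L'}λ₀(L)^{L} ≤ e^{δ}·λ₁(L)^{L}λ₀(L')^{L'}` holds for all matched incommensurable pairs beyond some `L₀(lam, δ)`, then
`UpStepEv` holds with `C = 1`: at level `lam` take `δ = lam² ≤ Λ²`.  So the item is a one-sided EVENTUAL (continuum-limit) comparison of
the femto gap across cutoffs at fixed running parameter; the `O(Λ²)` slack imposes nothing. [cite: LuscherWeiszWolff1991] [cite: Symanzik1983] -/
theorem upStepEv_of_eventually {lam0 : ℝ} (hlam0 : 0 < lam0)
    (h : ∀ lam : ℝ, 0 < lam → lam ≤ lam0 → ∀ δ : ℝ, 0 < δ → ∃ L0 : ℕ,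
      ∀ (L' : ℕ) [NeZero L'] (L : ℕ) [NeZero L], L0 ≤ L' → L' < L → L < 2 * L' → ∀ β β' : ℝ,
        InFemtoWindow lam β L → InFemtoWindow lam β' L' → luscherLambda β L = luscherLambda β' L' →
          secondValue su2Rep L' β' ^ L' * topValue su2Rep L β ^ L ≤
            Real.exp δ * (secondValue su2Rep L β ^ L * topValue su2Rep L' β' ^ L')) :
    UpStepEv := by
  refine ⟨1, lam0, hlam0, fun lam hlam hle => ?_⟩
  obtain ⟨L0, HL⟩ := h lam hlam hle (lam ^ 2) (by positivity)
  refine ⟨L0, fun L' _ L _ hL0 hlt hlt2 β β' hW hW' hm => ?_⟩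
  have ha : 0 ≤ secondValue su2Rep L' β' ^ L' * topValue su2Rep L β ^ L :=
    mul_nonneg (pow_nonneg (secondValue_su2Rep_pos (zero_lt_one.trans_le hW'.1)).le _)
      (pow_nonneg (topValue_su2Rep_pos L β).le _)
  exact le_exp_mul_mono ha (sq_le_one_mul_luscherLambda_sq hlam hW) (HL L' L hL0 hlt hlt2 β β' hW hW' hm)

/-- ★ **`C` is idle in the eventually form of the STABILITY direction too** (the reshaped `SubOctaveBounded`, hypothesis `h₂` of
`femtoGapOfRecord_of_octave_subOctaveEventually_fixedLattice`): any tolerance `e^{δ}` eventually in `L₀(lam, δ)` gives it with `C = 1`.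
Only the item AS FILED (stmt-QuantumFields-24085, `L₀` before `lam`) makes `C` carry weight. [cite: Symanzik1983] -/
theorem subOctaveBoundedEv_of_eventually {lam0 : ℝ} (hlam0 : 0 < lam0)
    (h : ∀ lam : ℝ, 0 < lam → lam ≤ lam0 → ∀ δ : ℝ, 0 < δ → ∃ L0 : ℕ,
      ∀ (L' : ℕ) [NeZero L'] (L : ℕ) [NeZero L], L0 ≤ L' → L' ≤ L → L < 2 * L' → ∀ β β' : ℝ,
        InFemtoWindow lam β L → InFemtoWindow lam β' L' → luscherLambda β L = luscherLambda β' L' →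
          secondValue su2Rep L β ^ L * topValue su2Rep L' β' ^ L' ≤
            Real.exp δ * (secondValue su2Rep L' β' ^ L' * topValue su2Rep L β ^ L)) :
    ∃ C lam0 : ℝ, 0 < lam0 ∧ ∀ lam : ℝ, 0 < lam → lam ≤ lam0 → ∃ L0 : ℕ,
      ∀ (L' : ℕ) [NeZero L'] (L : ℕ) [NeZero L], L0 ≤ L' → L' ≤ L → L < 2 * L' →
        ∀ β β' : ℝ, InFemtoWindow lam β L → InFemtoWindow lam β' L' → luscherLambda β L = luscherLambda β' L' →
          secondValue su2Rep L β ^ L * topValue su2Rep L' β' ^ L' ≤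
            Real.exp (C * luscherLambda β L ^ 2) * (secondValue su2Rep L' β' ^ L' * topValue su2Rep L β ^ L) := by
  refine ⟨1, lam0, hlam0, fun lam hlam hle => ?_⟩
  obtain ⟨L0, HL⟩ := h lam hlam hle (lam ^ 2) (by positivity)
  refine ⟨L0, fun L' _ L _ hL0 hle' hlt2 β β' hW hW' hm => ?_⟩
  have ha : 0 ≤ secondValue su2Rep L β ^ L * topValue su2Rep L' β' ^ L' :=
    mul_nonneg (pow_nonneg (secondValue_su2Rep_pos (zero_lt_one.trans_le hW.1)).le _)
      (pow_nonneg (topValue_su2Rep_pos L' β').le _)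
  exact le_exp_mul_mono ha (sq_le_one_mul_luscherLambda_sq hlam hW) (HL L' L hL0 hle' hlt2 β β' hW hW' hm)

/-- ★ **The leaf from the STABILITY direction with arbitrary tolerance**: `OctaveStepDecay`, the eventual δ-stability comparison (every
`δ > 0`, eventually in `L₀(lam, δ)`) and the fixed-lattice law give `FemtoGapOfRecord` — `subOctaveBoundedEv_of_eventually` fed into the
landed certificate `femtoGapOfRecord_of_octave_subOctaveEventually_fixedLattice` (seat g3, Certificate 1). [cite: LuscherWeiszWolff1991] -/
theorem femtoGapOfRecord_of_octave_stabilityEventually_fixedLattice (h₁ : OctaveStepDecay) {lam0 : ℝ} (hlam0 : 0 < lam0)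
    (h : ∀ lam : ℝ, 0 < lam → lam ≤ lam0 → ∀ δ : ℝ, 0 < δ → ∃ L0 : ℕ,
      ∀ (L' : ℕ) [NeZero L'] (L : ℕ) [NeZero L], L0 ≤ L' → L' ≤ L → L < 2 * L' → ∀ β β' : ℝ,
        InFemtoWindow lam β L → InFemtoWindow lam β' L' → luscherLambda β L = luscherLambda β' L' →
          secondValue su2Rep L β ^ L * topValue su2Rep L' β' ^ L' ≤
            Real.exp δ * (secondValue su2Rep L' β' ^ L' * topValue su2Rep L β ^ L))
    (hFL : FemtoGapFixedLattice) : FemtoGapOfRecord :=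
  femtoGapOfRecord_of_octave_subOctaveEventually_fixedLattice h₁ (subOctaveBoundedEv_of_eventually hlam0 h) hFL

/-- ★★ **`C` is idle in the pinned engine `PinnedUpStep`** (stmt-QuantumFields-26925), named form: if for every small level and EVERY
tolerance `δ > 0` the pinned time-1 moment inequality holds with slack `e^{δ}` beyond some `L₀(lam, δ)`, the item holds with `C = 1`.
What a supplier must deliver is therefore: eventually in the cutoff, at fixed running parameter, the normalised physical-time-1 vacuum
autocorrelation of the ONE pinned observable `f̄` on the fine lattice is `≥ e^{−δ}·(λ₁'/λ₀')^{L'}` — convergence from one side, no rate,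
no `O(Λ²)` matching. [cite: Luscher1983, §2] [cite: Balaban1985Averaging] -/
theorem pinnedUpStep_of_eventually_named {lam0 : ℝ} (hlam0 : 0 < lam0)
    (h : ∀ lam : ℝ, 0 < lam → lam ≤ lam0 → ∀ δ : ℝ, 0 < δ → ∃ L0 : ℕ,
      ∀ (L' : ℕ) [NeZero L'] (L : ℕ) [NeZero L], L0 ≤ L' → L' < L → L < 2 * L' → ∀ β β' : ℝ,
        InFemtoWindow lam β L → InFemtoWindow lam β' L' → luscherLambda β L = luscherLambda β' L' →
        ∀ Ω : GaugeConfig 3 L SU2 → ℝ, IsPhys Ω → (∀ U, 0 < Ω U) → l2 Ω Ω = 1 →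
          (∀ U, ∫ V, transferKernel su2Rep β U V * Ω V ∂(configMeasure SU2 L) = topValue su2Rep L β * Ω U) →
        ∀ Ω' : GaugeConfig 3 L' SU2 → ℝ, IsPhys Ω' → ∀ c' : ℝ, 0 < c' → (∀ U', c' ≤ Ω' U') → l2 Ω' Ω' = 1 →
          (∀ U', ∫ V', transferKernel su2Rep β' U' V' * Ω' V' ∂(configMeasure SU2 L') = topValue su2Rep L' β' * Ω' U') →
        ∀ φ' : GaugeConfig 3 L' SU2 → ℝ, IsPhys φ' → l2 φ' Ω' = 0 → l2 φ' φ' = 1 →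
          (∀ U', ∫ V', transferKernel su2Rep β' U' V' * φ' V' ∂(configMeasure SU2 L') = secondValue su2Rep L' β' * φ' U') →
        let ψ : GaugeConfig 3 L SU2 → ℝ := fun U =>
          ((Fintype.card (Site 3 L) : ℝ)⁻¹ *
            ∑ v : Site 3 L, φ' (thin L' (torusConfigShift v U)) / Ω' (thin L' (torusConfigShift v U))) * Ω U
        l2 ψ Ω ^ 2 < l2 ψ ψ ∧
          secondValue su2Rep L' β' ^ L' * topValue su2Rep L β ^ L * (l2 ψ ψ - l2 ψ Ω ^ 2) ≤
            Real.exp δ *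
              (topValue su2Rep L' β' ^ L' * (l2 ψ ((transferApply β)^[L] ψ) - topValue su2Rep L β ^ L * l2 ψ Ω ^ 2))) :
    PinnedUpStep := by
  rw [pinnedUpStep_iff_named]
  refine ⟨1, lam0, hlam0, fun lam hlam hle => ?_⟩
  obtain ⟨L0, HL⟩ := h lam hlam hle (lam ^ 2) (by positivity)
  refine ⟨L0, fun L' _ L _ hL0 hlt hlt2 β β' hW hW' hm Ω hΩ hpos hn heig Ω' hΩ' c' hc' hcle' hn' heig' φ' hφ' horth hn1 heig1 => ?_⟩
  have HB := HL L' L hL0 hlt hlt2 β β' hW hW' hm Ω hΩ hpos hn heig Ω' hΩ' c' hc' hcle' hn' heig' φ' hφ' horth hn1 heig1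
  simp only [] at HB ⊢
  obtain ⟨hvar, hineq⟩ := HB
  refine ⟨hvar, ?_⟩
  have ha : 0 ≤ secondValue su2Rep L' β' ^ L' * topValue su2Rep L β ^ L *
      (l2 (fun U : GaugeConfig 3 L SU2 => ((Fintype.card (Site 3 L) : ℝ)⁻¹ *
          ∑ v : Site 3 L, φ' (thin L' (torusConfigShift v U)) / Ω' (thin L' (torusConfigShift v U))) * Ω U)
        (fun U : GaugeConfig 3 L SU2 => ((Fintype.card (Site 3 L) : ℝ)⁻¹ *
          ∑ v : Site 3 L, φ' (thin L' (torusConfigShift v U)) / Ω' (thin L' (torusConfigShift v U))) * Ω U) -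
       l2 (fun U : GaugeConfig 3 L SU2 => ((Fintype.card (Site 3 L) : ℝ)⁻¹ *
          ∑ v : Site 3 L, φ' (thin L' (torusConfigShift v U)) / Ω' (thin L' (torusConfigShift v U))) * Ω U) Ω ^ 2) :=
    mul_nonneg (mul_nonneg (pow_nonneg (secondValue_su2Rep_pos (zero_lt_one.trans_le hW'.1)).le _)
      (pow_nonneg (topValue_su2Rep_pos L β).le _)) (sub_nonneg.mpr hvar.le)
  exact le_exp_mul_mono ha (sq_le_one_mul_luscherLambda_sq hlam hW) hineq

/-- ★★ **Corollary: `UpStepEv` from the pinned comparison with ARBITRARY tolerance** — `pinnedUpStep_of_eventually_named` followed by the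
landed glue `upStepEv_of_pinnedUpStep` (seat ym-idea-1 g5). [cite: ReedSimonIV1978, Thm. XIII.1] -/
theorem upStepEv_of_pinned_eventually_named {lam0 : ℝ} (hlam0 : 0 < lam0)
    (h : ∀ lam : ℝ, 0 < lam → lam ≤ lam0 → ∀ δ : ℝ, 0 < δ → ∃ L0 : ℕ,
      ∀ (L' : ℕ) [NeZero L'] (L : ℕ) [NeZero L], L0 ≤ L' → L' < L → L < 2 * L' → ∀ β β' : ℝ,
        InFemtoWindow lam β L → InFemtoWindow lam β' L' → luscherLambda β L = luscherLambda β' L' →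
        ∀ Ω : GaugeConfig 3 L SU2 → ℝ, IsPhys Ω → (∀ U, 0 < Ω U) → l2 Ω Ω = 1 →
          (∀ U, ∫ V, transferKernel su2Rep β U V * Ω V ∂(configMeasure SU2 L) = topValue su2Rep L β * Ω U) →
        ∀ Ω' : GaugeConfig 3 L' SU2 → ℝ, IsPhys Ω' → ∀ c' : ℝ, 0 < c' → (∀ U', c' ≤ Ω' U') → l2 Ω' Ω' = 1 →
          (∀ U', ∫ V', transferKernel su2Rep β' U' V' * Ω' V' ∂(configMeasure SU2 L') = topValue su2Rep L' β' * Ω' U') →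
        ∀ φ' : GaugeConfig 3 L' SU2 → ℝ, IsPhys φ' → l2 φ' Ω' = 0 → l2 φ' φ' = 1 →
          (∀ U', ∫ V', transferKernel su2Rep β' U' V' * φ' V' ∂(configMeasure SU2 L') = secondValue su2Rep L' β' * φ' U') →
        let ψ : GaugeConfig 3 L SU2 → ℝ := fun U =>
          ((Fintype.card (Site 3 L) : ℝ)⁻¹ *
            ∑ v : Site 3 L, φ' (thin L' (torusConfigShift v U)) / Ω' (thin L' (torusConfigShift v U))) * Ω U
        l2 ψ Ω ^ 2 < l2 ψ ψ ∧
          secondValue su2Rep L' β' ^ L' * topValue su2Rep L β ^ L * (l2 ψ ψ - l2 ψ Ω ^ 2) ≤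
            Real.exp δ *
              (topValue su2Rep L' β' ^ L' * (l2 ψ ((transferApply β)^[L] ψ) - topValue su2Rep L β ^ L * l2 ψ Ω ^ 2))) :
    UpStepEv :=
  upStepEv_of_pinnedUpStep (pinnedUpStep_of_eventually_named hlam0 h)

end Summit.QuantumFields.YangMills.Theorems.FemtoCutoffLadder.PinnedUpStepNamed

end
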